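import Literature.NumberTheory.Transcendental.PhilipponCriterionHomogenization
import Literature.RingTheory.KrullDimension.AffineDimension
import Mathlib.RingTheory.Ideal.Quotient.Operations
import Mathlib.RingTheory.Polynomial.Basic
import Mathlib.FieldTheory.IntermediateField.Adjoin.Basic
import HarnessLib

/-!
# Philippon's criterion over Nesterenko's toolkit, IV: the rank of the cone ideal of `(1, θ)` — proofs only

`Literature/NumberTheory/Transcendental/PhilipponCriterionConeRank.lean` — proofs only (no new
definitions, nothing asserted). Fourth glue layer of the programme deriving
`Philippon1986_mainCriterion` (`PhilipponCriterion.lean`, Philippon 1986 Thm 2.11 in Diaz's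
transcendence-degree form) from Nesterenko's toolkit (LNM 1752 Ch. 3 §4).

Philippon's Théorème 2.11 is stated for a prime `𝔓 ⊂ K[X₁, …, X_n]` of codimension `n − k` all of
whose elements vanish at `θ`; Diaz's form replaces it by the hypothesis `trdeg_ℚ ℚ(θ) ≤ k`. On
Nesterenko's side the induction starts from the homogeneous prime `𝔭_ω̄ = coneIdeal ω̄` of all
polynomials whose homogeneous components vanish at `ω̄ = (1, θ)` (`NesterenkoElimination.lean`),
and what is needed is its RANK: `1 ≤ dim ℚ[x̲] ⧸ 𝔭_ω̄ ≤ trdeg_ℚ ℚ(θ) + 1` (in fact equality holds).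
This is the dimension count printed in LNM 1752 Ch. 3 §5, p. 42 ("`dim 𝔭 = tr deg_ℚ ℚ(ω̄)`"),
proved in the tree for the point `(1, q, P(q), Q(q), R(q))` as
`Literature.Barriers.Schanuel.ringKrullDim_quotient_coneIdeal_le`; here the same argument is run
for an arbitrary `ω̄ = (1, θ)`, `θ ∈ ℂⁿ`: `ℚ[x̲] ⧸ 𝔭_ω̄ ≅ ℚ[t, θ₁t, …, θ_n t] ⊂ K₀[t]`,
`K₀ = ℚ(θ)`, so `trdeg_ℚ (ℚ[x̲] ⧸ 𝔭_ω̄) ≤ trdeg_ℚ K₀ + 1` (`Algebra.trdeg_add_eq`,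
`Polynomial.trdeg_of_isDomain`), `≥ 1` (`x₀ ↦ t` is transcendental), and `dim = trdeg` for affine
domains (`Literature.RingTheory.KrullDimension.ringKrullDim_eq_trdeg`, Matsumura Thm 5.6).

* `exists_ringKrullDim_quotient_coneIdeal` — `∃ r, 1 ≤ r ≤ k + 1`, `dim ℚ[x̲] ⧸ 𝔭_ω̄ = r`, when
  `trdeg_ℚ ℚ(θ) ≤ k`;
* `exists_isUnmixedOfRank_coneIdeal` — the same as `IsUnmixedOfRank (coneIdeal ω̄) r`.

## References

* [NesterenkoPhilippon2001] LNM 1752 (2001), Ch. 3 §5, p. 42 (the dimension count).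
* [Philippon1986Criteres] P. Philippon, Publ. Math. IHÉS 64 (1986), Thm 2.11 and §3 (the prime `𝔓`).
* [Matsumura1987] H. Matsumura, *Commutative Ring Theory*, Thm 5.6.
-/

noncomputable section

open MvPolynomial IntermediateField
open Literature.NumberTheory.Transcendental.Nesterenko

namespace Literature.NumberTheory.Transcendental

namespace PhilipponMain

variable {n : ℕ}

/-- Every coordinate of `ω̄ = (1, θ)` lies in `K₀ = ℚ(θ₁, …, θ_n)`. [folklore] -/
theorem cons_one_mem_adjoin (θ : Fin n → ℂ) (i : Fin (n + 1)) :
    (Fin.cons 1 θ : Fin (n + 1) → ℂ) i ∈ adjoin ℚ (Set.range θ) := by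
  refine Fin.cases ?_ (fun j => ?_) i
  · exact (adjoin ℚ _).one_mem
  · rw [cons_one_succ]
    exact IntermediateField.subset_adjoin ℚ _ ⟨j, rfl⟩

/-- **The rank of the cone ideal** (the dimension count of LNM 1752 Ch. 3 §5, p. 42, for a general
point): if `trdeg_ℚ ℚ(θ) ≤ k` then `r = dim ℚ[x₀, …, x_n] ⧸ 𝔭_ω̄`, `ω̄ = (1, θ)`, is a natural
number with `1 ≤ r ≤ k + 1`. [cite: NesterenkoPhilippon2001, Ch. 3 §5 (p. 42)] -/
theorem exists_ringKrullDim_quotient_coneIdeal (θ : Fin n → ℂ) {k : ℕ}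
    (hK : Algebra.trdeg ℚ ↥(adjoin ℚ (Set.range θ)) ≤ k) :
    ∃ r : ℕ, 1 ≤ r ∧ r ≤ k + 1 ∧
      ringKrullDim (Rx n ⧸ coneIdeal (Fin.cons 1 θ : Fin (n + 1) → ℂ)) = r := by
  set K₀ := adjoin ℚ (Set.range θ) with hK₀
  set ω : Fin (n + 1) → ℂ := Fin.cons 1 θ with hω
  set 𝔭 : Ideal (Rx n) := coneIdeal ω with h𝔭
  haveI h𝔭p : 𝔭.IsPrime := isPrime_coneIdeal ω
  -- the substitution `xᵢ ↦ ωᵢ t` with values in `K₀[t]`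
  let ω' : Fin (n + 1) → K₀ := fun i => ⟨ω i, cons_one_mem_adjoin θ i⟩
  let φ₀ : Rx n →ₐ[ℚ] Polynomial K₀ :=
    aeval fun i : Fin (n + 1) => Polynomial.C (ω' i) * Polynomial.X
  let ι : Polynomial K₀ →ₐ[ℚ] Polynomial ℂ := (Polynomial.mapAlg K₀ ℂ).restrictScalars ℚ
  have hιmap : ∀ f, ι f = Polynomial.map (algebraMap K₀ ℂ) f := fun f => by
    simp [ι, Polynomial.mapAlg_eq_map]
  have hι : Function.Injective ι := fun f g hfg => by
    rw [hιmap, hιmap] at hfg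
    exact Polynomial.map_injective _ (algebraMap K₀ ℂ).injective hfg
  have hcomp : (ι.comp φ₀ : Rx n →ₐ[ℚ] Polynomial ℂ) =
      aeval fun i : Fin (n + 1) => Polynomial.C (ω i) * Polynomial.X := by
    refine MvPolynomial.algHom_ext fun i => ?_
    rw [AlgHom.comp_apply, hιmap]
    simp [φ₀, ω']
  have hker : RingHom.ker φ₀ = 𝔭 := by
    rw [h𝔭, coneIdeal, ← hcomp]
    ext P
    simp only [RingHom.mem_ker, AlgHom.coe_comp, Function.comp_apply]
    rw [← map_zero ι]
    exact hι.eq_iff.symm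
  -- `A = ℚ[x̲]/𝔭` is an affine domain over `ℚ`
  haveI : IsDomain (Rx n ⧸ 𝔭) := Ideal.Quotient.isDomain 𝔭
  haveI : Algebra.FiniteType ℚ (Rx n ⧸ 𝔭) :=
    Algebra.FiniteType.of_surjective (Ideal.Quotient.mkₐ ℚ 𝔭) (Ideal.Quotient.mkₐ_surjective ℚ 𝔭)
  have hdim := Literature.RingTheory.KrullDimension.ringKrullDim_eq_trdeg ℚ (Rx n ⧸ 𝔭)
  have hfin : Algebra.trdeg ℚ (Rx n ⧸ 𝔭) < Cardinal.aleph0 :=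
    trdeg_lt_aleph0 (R := ℚ) (S := Rx n ⧸ 𝔭)
  -- the injection `A ↪ K₀[t]`
  have h0 : ∀ a : Rx n, a ∈ 𝔭 → φ₀ a = 0 := fun a ha => by
    rwa [← hker, RingHom.mem_ker] at ha
  let ψ : (Rx n ⧸ 𝔭) →ₐ[ℚ] Polynomial K₀ := Ideal.Quotient.liftₐ 𝔭 φ₀ h0
  have hψ : Function.Injective ψ := by
    have e : ⇑ψ = ⇑(Ideal.Quotient.lift 𝔭 (φ₀ : Rx n →+* Polynomial K₀) h0) :=
      funext fun x => Ideal.Quotient.liftₐ_apply 𝔭 φ₀ h0 x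
    rw [e]
    exact RingHom.lift_injective_of_ker_le_ideal 𝔭 h0 hker.le
  -- upper bound: `trdeg_ℚ A ≤ trdeg_ℚ K₀[t] = trdeg_ℚ K₀ + 1 ≤ k + 1`
  have hup : Algebra.trdeg ℚ (Rx n ⧸ 𝔭) ≤ k + 1 := by
    refine (trdeg_le_of_injective ψ hψ).trans ?_
    haveI : FaithfulSMul ℚ K₀ :=
      (faithfulSMul_iff_algebraMap_injective ℚ K₀).mpr (algebraMap ℚ K₀).injective
    rw [← trdeg_add_eq ℚ K₀ (A := Polynomial K₀), Polynomial.trdeg_of_isDomain]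
    gcongr
  -- lower bound: `x₀ ↦ t` is transcendental, so `trdeg_ℚ A ≥ 1`
  have hlow : 1 ≤ Algebra.trdeg ℚ (Rx n ⧸ 𝔭) := by
    have hω'0 : ω' 0 = 1 := Subtype.ext (by simp [ω', hω])
    have ht : Transcendental ℚ (Ideal.Quotient.mk 𝔭 (X 0) : Rx n ⧸ 𝔭) := by
      rintro ⟨p, hp0, hp⟩
      apply hp0
      have h1 : Polynomial.aeval (X 0 : Rx n) p ∈ 𝔭 := by
        rw [← Ideal.Quotient.eq_zero_iff_mem, ← Ideal.Quotient.mkₐ_eq_mk ℚ,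
          ← Polynomial.aeval_algHom_apply]
        exact hp
      rw [← hker, RingHom.mem_ker, ← Polynomial.aeval_algHom_apply] at h1
      have h2 : φ₀ (X 0) = Polynomial.X := by
        simp [φ₀, hω'0]
      rw [h2, ← Polynomial.aeval_map_algebraMap K₀ Polynomial.X p,
        Polynomial.aeval_X_left_apply,
        Polynomial.map_eq_zero_iff (algebraMap ℚ K₀).injective] at h1
      exact h1
    haveI : Algebra.Transcendental ℚ (Rx n ⧸ 𝔭) := ⟨⟨_, ht⟩⟩
    exact Cardinal.one_le_iff_pos.mpr (trdeg_pos ℚ (Rx n ⧸ 𝔭))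
  -- read off the natural number
  obtain ⟨r, hr⟩ := Cardinal.lt_aleph0.mp hfin
  refine ⟨r, ?_, ?_, ?_⟩
  · rw [hr] at hlow; exact_mod_cast hlow
  · rw [hr] at hup; exact_mod_cast hup
  · rw [hdim, hr, Cardinal.toNat_natCast]

/-- **The cone ideal of `(1, θ)` is a homogeneous prime of Nesterenko rank `r` with
`1 ≤ r ≤ trdeg_ℚ ℚ(θ) + 1 ≤ k + 1`** — the starting prime of Philippon's induction in Diaz's
transcendence-degree form. [cite: NesterenkoPhilippon2001, Ch. 3 §5 (p. 42)] -/
theorem exists_isUnmixedOfRank_coneIdeal (θ : Fin n → ℂ) {k : ℕ}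
    (hK : Algebra.trdeg ℚ ↥(adjoin ℚ (Set.range θ)) ≤ k) :
    ∃ r : ℕ, 1 ≤ r ∧ r ≤ k + 1 ∧ IsUnmixedOfRank (coneIdeal (Fin.cons 1 θ : Fin (n + 1) → ℂ)) r := by
  obtain ⟨r, hr1, hrk, hdim⟩ := exists_ringKrullDim_quotient_coneIdeal θ hK
  exact ⟨r, hr1, hrk, isUnmixedOfRank_of_isPrime (isPrime_coneIdeal _) hdim⟩

/-- The contrapositive reading of Diaz's conclusion: if NOT `k + 1 ≤ trdeg_ℚ ℚ(θ)` then
`trdeg_ℚ ℚ(θ) ≤ k`. [folklore] -/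
theorem trdeg_le_of_not_le {k : ℕ} (θ : Fin n → ℂ)
    (h : ¬ ((k + 1 : ℕ) : Cardinal) ≤ Algebra.trdeg ℚ ↥(adjoin ℚ (Set.range θ))) :
    Algebra.trdeg ℚ ↥(adjoin ℚ (Set.range θ)) ≤ k := by
  rw [not_le] at h
  have h' : Algebra.trdeg ℚ ↥(adjoin ℚ (Set.range θ)) < Order.succ (k : Cardinal) := by
    rwa [Cardinal.succ_natCast, ← Nat.cast_succ]
  exact Order.lt_succ_iff.mp h'

end PhilipponMain

end Literature.NumberTheory.Transcendental

end
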